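import Summits.QuantumAdvantage.QuantumAdvantage.Theorems.LocusDialGroupPointerAA

/-! # LocusDialGroupPointerA — part 2/2 (mechanical split for landing of `LocusDialGroupPointerA`; content verbatim; scopes re-opened with their variables) -/

set_option linter.dupNamespace false
noncomputable section
open scoped Classical

namespace Summit.QuantumAdvantage.QuantumAdvantage.Theorems.LocusDial
open Finset
open Literature.Computability.QuantumComplexity Literature.Computability.QuantumComplexity.RingHLF
open Summit.QuantumAdvantage.AdviceFreeQNC0
open Summit.QuantumAdvantage.QuantumAdvantage.Theorems.HolonomyDial (gCond)

/-- iterated trivial bound. -/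
theorem gQ_add_le (θ : ℕ → ℂ) (c : ℕ → ZMod 3) (hθ : ∀ k, Complex.normSq (θ k) = 1) (m i : ℕ) :
    gQ θ c (m + i) ≤ 4 ^ i * gQ θ c m := by
  induction i with
  | zero => simp
  | succ i ih =>
    calc gQ θ c (m + (i + 1)) = gQ θ c (m + i + 1) := by rw [Nat.add_assoc]
      _ ≤ 4 * gQ θ c (m + i) := gQ_succ_le θ c (m + i) (hθ _)
      _ ≤ 4 * (4 ^ i * gQ θ c m) := by nlinarith [ih]
      _ = 4 ^ (i + 1) * gQ θ c m := by ring

/-- iterated two-step bound `Q_{2j} ≤ 14^j`. -/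
theorem gQ_even_le (θ : ℕ → ℂ) (c : ℕ → ZMod 3) (hθ : ∀ k, Complex.normSq (θ k) = 1) (j : ℕ)
    (hc : ∀ i, i + 2 ≤ 2 * j → c i ≠ 0) : gQ θ c (2 * j) ≤ 14 ^ j := by
  induction j with
  | zero => simp [gQ_zero]
  | succ j ih =>
    have ih' := ih (fun i hi => hc i (by omega))
    calc gQ θ c (2 * (j + 1)) = gQ θ c (2 * j + 2) := by ring_nf
      _ ≤ 14 * gQ θ c (2 * j) := gQ_two_step θ c (2 * j) (hθ _) (hθ _) (hc (2 * j) (by omega))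
      _ ≤ 14 * 14 ^ j := by nlinarith [ih']
      _ = 14 ^ (j + 1) := by ring

/-- **the transfer bound** for unit bit phases: `|R_N(1)|² ≤ 4^{N-2j}·14^j`, `j = ⌊(N-1)/2⌋`. -/
theorem normSq_gR_le (θ : ℕ → ℂ) (c : ℕ → ZMod 3) (hθ : ∀ k, Complex.normSq (θ k) = 1) (N : ℕ)
    (hc : ∀ i, i + 1 < N → c i ≠ 0) :
    Complex.normSq (gR θ c N true) ≤ 4 ^ (N - 2 * ((N - 1) / 2)) * 14 ^ ((N - 1) / 2) := by
  set j := (N - 1) / 2 with hj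
  have h2j : 2 * j ≤ N := by omega
  have h1 : gQ θ c (2 * j) ≤ 14 ^ j := gQ_even_le θ c hθ j (fun i hi => hc i (by omega))
  have h2 : gQ θ c N ≤ 4 ^ (N - 2 * j) * gQ θ c (2 * j) := by
    have := gQ_add_le θ c hθ (2 * j) (N - 2 * j)
    rwa [Nat.add_sub_cancel' h2j] at this
  have h3 : Complex.normSq (gR θ c N true) ≤ gQ θ c N := by
    unfold gQ; nlinarith [Complex.normSq_nonneg (gR θ c N false)]
  calc Complex.normSq (gR θ c N true) ≤ gQ θ c N := h3
    _ ≤ 4 ^ (N - 2 * j) * gQ θ c (2 * j) := h2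
    _ ≤ 4 ^ (N - 2 * j) * 14 ^ j := by
        have : (0:ℝ) ≤ 4 ^ (N - 2 * j) := by positivity
        nlinarith [h1]

/-! ## §G  Walk sums with a multiplicative hash weight: `S_k(u) = Σ_{zpar_k(x)=u} (∏_{i<k, x_i} θ_i)·χ(Σ_{i<k} c_i[u_i])` -/

section WalkSums
variable {N : ℕ}

/-- the hash weight of the first `k` bits: `∏_{i<k, x_i = 1} θ_i`. -/
def hashProd (θ : ℕ → ℂ) (k : ℕ) (x : Fin N → Bool) : ℂ :=
  ∏ i : Fin N, if i.val < k ∧ x i = true then θ i.val else 1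

/-- the weighted walk sum over the inputs whose first `k` bits have zero-parity `u`. -/
def gS (θ : ℕ → ℂ) (c : ℕ → ZMod 3) (N k : ℕ) (u : Bool) : ℂ :=
  ∑ x ∈ (univ : Finset (Fin N → Bool)).filter (fun x => zpar x k = u),
    hashProd θ k x * χ (phaseK (fun _ => 0) c k x)

/-- the half sum: additionally the bit `K` is prescribed. -/
def gH (θ : ℕ → ℂ) (c : ℕ → ZMod 3) (N k : ℕ) (K : Fin N) (b u : Bool) : ℂ :=
  ∑ x ∈ (univ : Finset (Fin N → Bool)).filter (fun x => x K = b ∧ zpar x k = u),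
    hashProd θ k x * χ (phaseK (fun _ => 0) c k x)

/-- LocusDialGroupPointerA helper `hashProd_update_of_le` (decomp-qadv land package; see the module docstring). -/
theorem hashProd_update_of_le (θ : ℕ → ℂ) {k : ℕ} (x : Fin N → Bool) (K : Fin N) (hk : k ≤ K.val) (b : Bool) :
    hashProd θ k (Function.update x K b) = hashProd θ k x := by
  unfold hashProd
  apply prod_congr rfl
  intro i _
  by_cases hi : i.val < k
  · have hne : i ≠ K := by intro h; rw [h] at hi; omega
    rw [Function.update_of_ne hne]
  · rw [if_neg (fun h => hi h.1), if_neg (fun h => hi h.1)]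

/-- LocusDialGroupPointerA helper `hashProd_zero` (decomp-qadv land package; see the module docstring). -/
theorem hashProd_zero (θ : ℕ → ℂ) (x : Fin N → Bool) : hashProd θ 0 x = 1 := by
  unfold hashProd
  exact prod_eq_one (fun i _ => by simp)

/-- LocusDialGroupPointerA helper `hashProd_succ` (decomp-qadv land package; see the module docstring). -/
theorem hashProd_succ (θ : ℕ → ℂ) {k : ℕ} (hk : k < N) (x : Fin N → Bool) :
    hashProd θ (k + 1) x = hashProd θ k x * (if x ⟨k, hk⟩ = true then θ k else 1) := by
  unfold hashProd
  set K : Fin N := ⟨k, hk⟩ with hK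
  have hpt : ∀ i : Fin N, (if i.val < k + 1 ∧ x i = true then θ i.val else 1) =
      (if i.val < k ∧ x i = true then θ i.val else 1) * (if i = K then (if x i = true then θ i.val else 1) else 1) := by
    intro i
    by_cases h1 : i.val < k
    · have : i ≠ K := by intro heq; rw [heq, hK] at h1; simp at h1
      rw [if_neg this, mul_one]
      by_cases hx : x i = true
      · rw [if_pos ⟨by omega, hx⟩, if_pos ⟨h1, hx⟩]
      · rw [if_neg (fun h => hx h.2), if_neg (fun h => hx h.2)]
    · by_cases h2 : i = K
      · subst h2
        have hkk : (K.val < k + 1) := by simp [hK]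
        have hnk : ¬ (K.val < k) := h1
        by_cases hx : x K = true
        · rw [if_pos ⟨hkk, hx⟩, if_neg (fun h => hnk h.1), if_pos rfl, if_pos hx, one_mul]
        · rw [if_neg (fun h => hx h.2), if_neg (fun h => hnk h.1), if_pos rfl, if_neg hx, one_mul]
      · have : ¬ i.val < k + 1 := by
          intro h; apply h2; apply Fin.ext; rw [hK]; simp; omega
        rw [if_neg (fun h => this h.1), if_neg (fun h => h1 h.1), if_neg h2, mul_one]
  simp_rw [hpt]
  rw [prod_mul_distrib, Finset.prod_ite_eq' univ K, if_pos (mem_univ K)]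

/-- the two halves are equal (flip the prescribed bit: weight, phase and parity read only earlier bits). -/
theorem gH_true_eq_false (θ : ℕ → ℂ) (c : ℕ → ZMod 3) {k : ℕ} (K : Fin N) (hk : k ≤ K.val) (u : Bool) :
    gH θ c N k K true u = gH θ c N k K false u := by
  unfold gH
  refine sum_nbij' (fun x => Function.update x K false) (fun x => Function.update x K true) ?_ ?_ ?_ ?_ ?_
  · intro x hx
    simp only [mem_filter, mem_univ, true_and] at hx ⊢
    exact ⟨by simp, by rw [zpar_update_of_le x K hk]; exact hx.2⟩
  · intro x hx
    simp only [mem_filter, mem_univ, true_and] at hx ⊢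
    exact ⟨by simp, by rw [zpar_update_of_le x K hk]; exact hx.2⟩
  · intro x hx
    simp only [mem_filter, mem_univ, true_and] at hx
    rw [Function.update_idem, ← hx.1, Function.update_eq_self]
  · intro x hx
    simp only [mem_filter, mem_univ, true_and] at hx
    rw [Function.update_idem, ← hx.1, Function.update_eq_self]
  · intro x _
    rw [phaseK_update_of_le (fun _ => 0) c x K hk, hashProd_update_of_le θ x K hk]

/-- the two halves add up to the walk sum. -/
theorem gH_add (θ : ℕ → ℂ) (c : ℕ → ZMod 3) (k : ℕ) (K : Fin N) (u : Bool) :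
    gH θ c N k K true u + gH θ c N k K false u = gS θ c N k u := by
  unfold gH gS
  rw [sum_filter, sum_filter, sum_filter, ← sum_add_distrib]
  apply sum_congr rfl
  intro x _
  cases hx : x K <;> simp

/-- LocusDialGroupPointerA helper `two_mul_gH` (decomp-qadv land package; see the module docstring). -/
theorem two_mul_gH (θ : ℕ → ℂ) (c : ℕ → ZMod 3) {k : ℕ} (K : Fin N) (hk : k ≤ K.val) (b u : Bool) :
    2 * gH θ c N k K b u = gS θ c N k u := by
  rw [two_mul, ← gH_add θ c k K u]
  cases b
  · rw [gH_true_eq_false θ c K hk]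
  · rw [gH_true_eq_false θ c K hk]

/-- the walk recursion at the level of weighted sums. -/
theorem gS_succ (θ : ℕ → ℂ) (c : ℕ → ZMod 3) {k : ℕ} (hk : k < N) (u' : Bool) :
    gS θ c N (k + 1) u' = χ (if u' then c k else 0) *
      (θ k * gH θ c N k ⟨k, hk⟩ true u' + gH θ c N k ⟨k, hk⟩ false (!u')) := by
  have hpt : ∀ x : Fin N → Bool,
      (if zpar x (k + 1) = u' then hashProd θ (k + 1) x * χ (phaseK (fun _ => 0) c (k + 1) x) else 0) =
        χ (if u' then c k else 0) *
          (θ k * (if (x ⟨k, hk⟩ = true ∧ zpar x k = u') then hashProd θ k x * χ (phaseK (fun _ => 0) c k x) else 0)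
          + (if (x ⟨k, hk⟩ = false ∧ zpar x k = !u') then hashProd θ k x * χ (phaseK (fun _ => 0) c k x) else 0)) := by
    intro x
    have hu : uCoord x ⟨k, hk⟩ = zpar x (k + 1) := by rw [uCoord_eq_zpar]
    have hz : zpar x (k + 1) = xor (zpar x k) (!x ⟨k, hk⟩) := zpar_succ x hk
    have hph := phaseK_succ (fun _ => (0 : ZMod 3)) c hk x
    rw [hu] at hph
    rw [hph, hz, hashProd_succ θ hk x]
    cases hxK : x ⟨k, hk⟩ <;> cases hzk : zpar x k <;> cases u' <;>
      simp [χ_add, χ_zero] <;> ring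
  unfold gS gH
  rw [sum_filter, sum_filter, sum_filter]
  simp_rw [hpt]
  rw [mul_sum, ← sum_add_distrib, mul_sum]

/-- **the transfer identity** `S_k(u) = 2^{N-k}·R_k(u)` for weighted sums. -/
theorem gS_eq (θ : ℕ → ℂ) (c : ℕ → ZMod 3) :
    ∀ k, k ≤ N → ∀ u : Bool, gS θ c N k u = 2 ^ (N - k) * gR θ c k u := by
  intro k
  induction k with
  | zero =>
    intro _ u
    unfold gS
    have hf : ∀ x : Fin N → Bool, zpar x 0 = false := fun x => zpar_zero x
    cases u
    · have hset : (univ.filter fun x : Fin N → Bool => zpar x 0 = false) = univ :=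
        filter_true_of_mem (fun x _ => hf x)
      rw [hset]
      simp only [phaseK_zero, χ_zero, hashProd_zero, mul_one, sum_const, card_univ, Fintype.card_fun,
        Fintype.card_bool, Fintype.card_fin, nsmul_eq_mul, Nat.sub_zero, gR, Bool.false_eq_true, if_false]
      push_cast
      ring
    · have hset : (univ.filter fun x : Fin N → Bool => zpar x 0 = true) = ∅ :=
        filter_false_of_mem (fun x _ => by rw [hf x]; exact Bool.false_ne_true)
      rw [hset, sum_empty]
      simp [gR]
  | succ k ih =>
    intro hk u'
    have hkN : k < N := by omega
    have ih' := ih (by omega)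
    have hH : ∀ b u, gH θ c N k ⟨k, hkN⟩ b u = 2 ^ (N - k - 1) * gR θ c k u := by
      intro b u
      have h2 := two_mul_gH θ c (N := N) ⟨k, hkN⟩ (le_refl k) b u
      rw [ih' u, show N - k = (N - k - 1) + 1 by omega, pow_succ] at h2
      have : (2 : ℂ) * gH θ c N k ⟨k, hkN⟩ b u = 2 * (2 ^ (N - k - 1) * gR θ c k u) := by
        rw [h2]; ring
      exact mul_left_cancel₀ (by norm_num) this
    rw [gS_succ θ c hkN u', hH, hH, show N - (k + 1) = N - k - 1 by omega]
    simp only [gR]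
    ring

/-- at the top the weighted walk sum is the ODD-CLASS sum of weight × full phase. -/
theorem gS_top (θ : ℕ → ℂ) (c : ℕ → ZMod 3) :
    gS θ c N N true = ∑ x ∈ (univ : Finset (Fin N → Bool)).filter (fun x => OddZeros x),
      hashProd θ N x * χ (phaseK (fun _ => 0) c N x) := by
  unfold gS
  apply sum_congr _ (fun _ _ => rfl)
  apply filter_congr
  intro x _
  unfold zpar OddZeros
  rw [decide_eq_true_iff]
  have : (univ.filter fun j : Fin N => j.val < N ∧ x j = false) = univ.filter fun j : Fin N => x j = false :=
    filter_congr (fun j _ => by simp [j.isLt])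
  rw [this]

/-- **the weighted odd-class sum bound**: unit bit weights `θ`, occupation phases `c_i ≠ 0` (`i + 1 < N`):
`|Σ_{x odd} (∏_{x_i=1} θ_i) χ(Σ c_i[u_i])|² ≤ 4^{N-2j}·14^j`. -/
theorem normSq_oddSumG_le (θ : ℕ → ℂ) (c : ℕ → ZMod 3) (hθ : ∀ k, Complex.normSq (θ k) = 1)
    (hc : ∀ i, i + 1 < N → c i ≠ 0) :
    Complex.normSq (∑ x ∈ (univ : Finset (Fin N → Bool)).filter (fun x => OddZeros x),
      hashProd θ N x * χ (phaseK (fun _ => 0) c N x)) ≤ 4 ^ (N - 2 * ((N - 1) / 2)) * 14 ^ ((N - 1) / 2) := by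
  rw [← gS_top, gS_eq θ c N (le_refl N) true, Nat.sub_self, pow_zero, one_mul]
  exact normSq_gR_le θ c hθ N hc

end WalkSums

end Summit.QuantumAdvantage.QuantumAdvantage.Theorems.LocusDial
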